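import Summits.CriticalPhenomena.PercolationContinuityZ3.Theorems.PercNearOneGluingNoHeavyLowerTailMajorityGluingTypeTableFixedMGrid
import Summits.CriticalPhenomena.PercolationContinuityZ3.Theorems.PercNearOneGluingNoHeavyLowerTailMajorityGluingTypeTableBottomRegimeA
import HarnessLib

/-!
# The fixed-`M` programme in the kernel, template B (support bounds and the generic cut lemma)
(lane prim-rate, constants-miner 1, gen 28; KERNEL-WINDOW.md §1–§4; CONVEX-BOOTSTRAP.md §5; RIGOROUS-CERTIFICATION.md §1)

Support file for the closed crux `NoHeavyLowerTail` (stmt-CriticalPhenomena-4575), majority-gluing line; continuation of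
`…TypeTableFixedMGrid`.  (i) The SUPPORT BOUNDS that turn a power row with several factors into one with two supports:
relay-triple `ρ_f ≤ 2`, `S_z + T_z ≤ 2`, hub-set `ρ₀^{0S}, ρ_t^{0S} ≤ 1` (typewise facts by `decide` + `cut_le_one`; `ρ₀^{0ab} ≤ 1`
is `rho0_le_one`), `Π_z(S_z+T_z) ≤ 4(S_a+T_a)(S_b+T_b)`, and the JUNK row `S_z − T_z + E − j_z ≤ 0`; (ii) the exponent facts of
`c₃, c₄, 5/2`; (iii) the generic real step `tangent_of_power_row` (power row ⟹ root form ⟹ Kelley tangent, via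
`RpowCert.root_le_of_rpow_le` and `ConvexBootstrap.tangent_two_rounded`), the monotone assembly of the certified constants
(`h_of_cert`, `g_of_cert`) and `cut_sound`: a power row `u^c ≤ K·F·s·t` with `F ≤ R`, `(KR)^{1/c} ≤ Cu`, the support point on
the grid and the three rational checks of `TRow.ok` give the scaled row `N·u − G₁s − G₂t ≤ H`.  No sorries.
[cite: VandenbergHaggstromKahn2005, Thm. 1.3 (p. 6)]
-/

namespace Summit.CriticalPhenomena.PercolationContinuityZ3.Theorems

namespace HubOnly
namespace TypeTable

open DType

noncomputable section

/-! ### Support bounds from the budgets -/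

/-- Typewise: `ρ_f^{abc} ≤ 1[v_f cut] + 1[v_g cut]` for `f ≠ g` in the triple (if `v_f` is attached and isolated from
the other two, both are cut). -/
theorem rho3_cut_combo : ∀ τ ∈ allTypes, ∀ a ∈ [1, 2, 3, 4], ∀ b ∈ [1, 2, 3, 4], ∀ c ∈ [1, 2, 3, 4], a < b → b < c →
    ∀ f ∈ [1, 2, 3, 4], ∀ g ∈ [1, 2, 3, 4], (f = a ∨ f = b ∨ f = c) → (g = a ∨ g = b ∨ g = c) → f ≠ g →
    combo [(1, fun τ => ind (τ.rho [a, b, c] f)), (-1, fun τ => τ.cutZ f), (-1, fun τ => τ.cutZ g)] τ ≤ 0 := by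
  decide +kernel

/-- Typewise: `1[S_z] + 1[T_z] ≤ 1[v_z cut] + 1[v_w cut]` for `w ≠ z`. -/
theorem st_cut_combo : ∀ τ ∈ allTypes, ∀ z ∈ [1, 2, 3, 4], ∀ w ∈ [1, 2, 3, 4], z ≠ w →
    combo [(1, fun τ => ind (τ.isS z)), (1, fun τ => ind (τ.isT z)), (-1, fun τ => τ.cutZ z),
      (-1, fun τ => τ.cutZ w)] τ ≤ 0 := by
  decide +kernel

/-- `ρ_f^{abc}(x) ≤ 2` under the normalisation and the budgets. -/
theorem rho3_le_two (x : DType → ℝ) (hx : ∀ τ, 0 ≤ x τ) (hnorm : lin (fun τ => τ.cutZ 1) x ≤ 1)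
    (hB2 : lin (fun τ => τ.bud 2) x ≤ 0) (hB3 : lin (fun τ => τ.bud 3) x ≤ 0)
    (hB4 : lin (fun τ => τ.bud 4) x ≤ 0) {a b c : ℕ} (ha : a ∈ [1, 2, 3, 4]) (hb : b ∈ [1, 2, 3, 4])
    (hc : c ∈ [1, 2, 3, 4]) (hab : a < b) (hbc : b < c) {f g : ℕ} (hf : f ∈ [1, 2, 3, 4]) (hg : g ∈ [1, 2, 3, 4])
    (hf3 : f = a ∨ f = b ∨ f = c) (hg3 : g = a ∨ g = b ∨ g = c) (hfg : f ≠ g) :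
    lin (fun τ => ind (τ.rho [a, b, c] f)) x ≤ 2 := by
  have h := cc_bound _ x (fun τ hτ => rho3_cut_combo τ hτ a ha b hb c hc hab hbc f hf g hg hf3 hg3 hfg) hx
  simp only [List.map_cons, List.map_nil, List.sum_cons, List.sum_nil] at h
  push_cast at h
  have h1 := cut_le_one x hx hnorm hB2 hB3 hB4 f hf
  have h2 := cut_le_one x hx hnorm hB2 hB3 hB4 g hg
  linarith

/-- `S_z(x) + T_z(x) ≤ 2` under the normalisation and the budgets. -/
theorem st_le_two (x : DType → ℝ) (hx : ∀ τ, 0 ≤ x τ) (hnorm : lin (fun τ => τ.cutZ 1) x ≤ 1)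
    (hB2 : lin (fun τ => τ.bud 2) x ≤ 0) (hB3 : lin (fun τ => τ.bud 3) x ≤ 0)
    (hB4 : lin (fun τ => τ.bud 4) x ≤ 0) : ∀ z ∈ [1, 2, 3, 4], Sm z x + Tm z x ≤ 2 := by
  intro z hz
  have hw : ∃ w ∈ [1, 2, 3, 4], z ≠ w := by
    simp only [List.mem_cons, List.not_mem_nil, or_false] at hz
    rcases hz with rfl | rfl | rfl | rfl
    · exact ⟨2, by simp, by omega⟩
    · exact ⟨1, by simp, by omega⟩
    · exact ⟨1, by simp, by omega⟩
    · exact ⟨1, by simp, by omega⟩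
  obtain ⟨w, hw, hzw⟩ := hw
  have h := cc_bound _ x (fun τ hτ => st_cut_combo τ hτ z hz w hw hzw) hx
  simp only [List.map_cons, List.map_nil, List.sum_cons, List.sum_nil] at h
  push_cast at h
  have h1 := cut_le_one x hx hnorm hB2 hB3 hB4 z hz
  have h2 := cut_le_one x hx hnorm hB2 hB3 hB4 w hw
  simp only [Sm, Tm]
  linarith

/-- `Π_z (S_z+T_z) ≤ 4·(S_a+T_a)(S_b+T_b)` for `a < b`, all factors in `[0, 2]`. -/
theorem prod4_le (st : ℕ → ℝ) (h0 : ∀ z ∈ [1, 2, 3, 4], 0 ≤ st z) (h2 : ∀ z ∈ [1, 2, 3, 4], st z ≤ 2) {a b : ℕ}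
    (ha : a ∈ [1, 2, 3, 4]) (hb : b ∈ [1, 2, 3, 4]) (hab : a < b) :
    st 1 * st 2 * st 3 * st 4 ≤ 4 * st a * st b := by
  have k1 := h0 1 (by simp); have k2 := h0 2 (by simp); have k3 := h0 3 (by simp); have k4 := h0 4 (by simp)
  have l1 := h2 1 (by simp); have l2 := h2 2 (by simp); have l3 := h2 3 (by simp); have l4 := h2 4 (by simp)
  have P : ∀ {p q r s : ℝ}, 0 ≤ p → 0 ≤ q → 0 ≤ r → 0 ≤ s → r ≤ 2 → s ≤ 2 → p * q * r * s ≤ 4 * p * q := by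
    intro p q r s hp hq hr hs hr2 hs2
    have hrs : r * s ≤ 2 * 2 := mul_le_mul hr2 hs2 hs (by norm_num)
    have hpq : 0 ≤ p * q := mul_nonneg hp hq
    nlinarith
  simp only [List.mem_cons, List.not_mem_nil, or_false] at ha hb
  rcases ha with rfl | rfl | rfl | rfl <;> rcases hb with rfl | rfl | rfl | rfl <;> (try omega)
  · exact P k1 k2 k3 k4 l3 l4
  · calc st 1 * st 2 * st 3 * st 4 = st 1 * st 3 * st 2 * st 4 := by ring
      _ ≤ 4 * st 1 * st 3 := P k1 k3 k2 k4 l2 l4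
  · calc st 1 * st 2 * st 3 * st 4 = st 1 * st 4 * st 2 * st 3 := by ring
      _ ≤ 4 * st 1 * st 4 := P k1 k4 k2 k3 l2 l3
  · calc st 1 * st 2 * st 3 * st 4 = st 2 * st 3 * st 1 * st 4 := by ring
      _ ≤ 4 * st 2 * st 3 := P k2 k3 k1 k4 l1 l4
  · calc st 1 * st 2 * st 3 * st 4 = st 2 * st 4 * st 1 * st 3 := by ring
      _ ≤ 4 * st 2 * st 4 := P k2 k4 k1 k3 l1 l3
  · calc st 1 * st 2 * st 3 * st 4 = st 3 * st 4 * st 1 * st 2 := by ring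
      _ ≤ 4 * st 3 * st 4 := P k3 k4 k1 k2 l1 l2

/-- The JUNK row at law level: `S_z − T_z + E − j_z ≤ 0` under the budgets (`S_le_ctrl_junk_combo`, `ctrl_le`). -/
theorem junk_row_valid (x : DType → ℝ) (hx : ∀ τ, 0 ≤ x τ) (hB2 : lin (fun τ => τ.bud 2) x ≤ 0)
    (hB3 : lin (fun τ => τ.bud 3) x ≤ 0) (hB4 : lin (fun τ => τ.bud 4) x ≤ 0) {z : ℕ} (hz : z ∈ [1, 2, 3, 4]) :
    lin (combo [(1, fun τ => ind (τ.isS z)), (-1, fun τ => ind (τ.isT z)), (1, eZ), (-1, fun τ => ind (τ.junk z))]) x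
      ≤ 0 := by
  have h := cc_bound _ x (fun τ hτ => S_le_ctrl_junk_combo τ hτ z hz) hx
  have hc := ctrl_le x hB2 hB3 hB4 z hz
  simp only [List.map_cons, List.map_nil, List.sum_cons, List.sum_nil] at h
  simp only [lin_combo, List.map_cons, List.map_nil, List.sum_cons, List.sum_nil]
  push_cast at h ⊢
  simp only [Tm, E] at hc
  linarith

/-- Typewise: in a hub set `{0} ∪ S` every RELAY support is a cut event, `ρ_t^{0S} ≤ 1[v_t cut]`, and the hub support
needs all of `S` cut, `ρ₀^{0S} ≤ 1[v_s cut]` (`s` the first relay of `S`). -/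
theorem rho_hubset_combo : ∀ τ ∈ allTypes, ∀ S ∈ [[0, 1, 2, 3], [0, 1, 2, 4], [0, 1, 3, 4], [0, 2, 3, 4], [0, 1, 2, 3, 4]],
    (∀ t ∈ [1, 2, 3, 4], t ∈ S → combo [(1, fun τ => ind (τ.rho S t)), (-1, fun τ => τ.cutZ t)] τ ≤ 0) ∧
    combo [(1, fun τ => ind (τ.rho S 0)), (-1, fun τ => τ.cutZ (S.getD 1 1))] τ ≤ 0 := by
  decide +kernel

/-- Hub-set supports are at most `1` under the normalisation and the budgets. -/
theorem rho_hubset_le_one (x : DType → ℝ) (hx : ∀ τ, 0 ≤ x τ) (hnorm : lin (fun τ => τ.cutZ 1) x ≤ 1)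
    (hB2 : lin (fun τ => τ.bud 2) x ≤ 0) (hB3 : lin (fun τ => τ.bud 3) x ≤ 0)
    (hB4 : lin (fun τ => τ.bud 4) x ≤ 0) {S : List ℕ}
    (hS : S ∈ [[0, 1, 2, 3], [0, 1, 2, 4], [0, 1, 3, 4], [0, 2, 3, 4], [0, 1, 2, 3, 4]]) :
    (∀ t ∈ [1, 2, 3, 4], t ∈ S → lin (fun τ => ind (τ.rho S t)) x ≤ 1) ∧ lin (fun τ => ind (τ.rho S 0)) x ≤ 1 := by
  have hs1 : S.getD 1 1 ∈ [1, 2, 3, 4] := by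
    simp only [List.mem_cons, List.not_mem_nil, or_false] at hS
    rcases hS with rfl | rfl | rfl | rfl | rfl <;> simp
  constructor
  · intro t ht htS
    have h := cc_bound _ x (fun τ hτ => (rho_hubset_combo τ hτ S hS).1 t ht htS) hx
    simp only [List.map_cons, List.map_nil, List.sum_cons, List.sum_nil] at h
    push_cast at h
    have h1 := cut_le_one x hx hnorm hB2 hB3 hB4 t ht
    linarith
  · have h := cc_bound _ x (fun τ hτ => (rho_hubset_combo τ hτ S hS).2) hx
    simp only [List.map_cons, List.map_nil, List.sum_cons, List.sum_nil] at h
    push_cast at h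
    have h1 := cut_le_one x hx hnorm hB2 hB3 hB4 _ hs1
    linarith

/-! ### From a power row to a checked cut (real arithmetic) -/

/-- **Tangent of a power row.**  `u^c ≤ K·F·s·t` with `F ≤ R`, everything nonnegative, `c > 0`, `2/c ≤ 1`, a bound
`(K·R)^{1/c} ≤ C` and emitted constants dominating the tangent data of `C·(s·t)^{1/c}` at `(a,b)` ⟹ `u ≤ h + g₁s + g₂t`. -/
theorem tangent_of_power_row {u K F R s t c a b h g₁ g₂ C : ℝ} (hu : 0 ≤ u) (hK : 0 ≤ K) (hF : 0 ≤ F)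
    (hFR : F ≤ R) (hs : 0 ≤ s) (ht : 0 ≤ t) (hc : 0 < c) (hq2 : 2 * c⁻¹ ≤ 1) (row : u ^ c ≤ K * F * s * t)
    (ha : 0 < a) (hb : 0 < b) (hC : (K * R) ^ c⁻¹ ≤ C) (hh : C * (a * b) ^ c⁻¹ * (1 - 2 * c⁻¹) ≤ h)
    (hg₁ : C * c⁻¹ * (a * b) ^ c⁻¹ / a ≤ g₁) (hg₂ : C * c⁻¹ * (a * b) ^ c⁻¹ / b ≤ g₂) :
    u ≤ h + g₁ * s + g₂ * t := by
  have hR : 0 ≤ R := hF.trans hFR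
  have row' : u ^ c ≤ K * R * (s * t) := by
    have : K * F * s * t ≤ K * R * s * t :=
      mul_le_mul_of_nonneg_right (mul_le_mul_of_nonneg_right (mul_le_mul_of_nonneg_left hFR hK) hs) ht
    linarith [this]
  have h1 := RpowCert.root_le_of_rpow_le hu (mul_nonneg hK hR) hs ht hc row'
  have hst : 0 ≤ (s * t) ^ c⁻¹ := Real.rpow_nonneg (mul_nonneg hs ht) _
  have hC0 : 0 ≤ C := (Real.rpow_nonneg (mul_nonneg hK hR) _).trans hC
  have h2 : u ≤ C * (s * t) ^ c⁻¹ := h1.trans (mul_le_mul_of_nonneg_right hC hst)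
  exact h2.trans (ConvexBootstrap.tangent_two_rounded (inv_nonneg.mpr hc.le) hq2 ha hb hs ht hC0 hh hg₁ hg₂)

/-- The `h`-certificate: `0 ≤ C ≤ Cu`, `0 ≤ P ≤ Pu`, `QL ≤ q`, `2q ≤ 1`, `Cu·Pu·(1−2QL) ≤ h` ⟹ `C·P·(1−2q) ≤ h`. -/
theorem h_of_cert {C Cu P Pu q QL h : ℝ} (hC0 : 0 ≤ C) (hC : C ≤ Cu) (hP0 : 0 ≤ P) (hP : P ≤ Pu) (hq : QL ≤ q)
    (hq1 : 2 * q ≤ 1) (hcert : Cu * Pu * (1 - 2 * QL) ≤ h) : C * P * (1 - 2 * q) ≤ h := by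
  have h1 : C * P ≤ Cu * Pu := RpowCert.mul_le_cert hC0 hC hP0 hP
  have h2 : 0 ≤ 1 - 2 * q := by linarith
  have h3 : C * P * (1 - 2 * q) ≤ Cu * Pu * (1 - 2 * q) := mul_le_mul_of_nonneg_right h1 h2
  have h4 : Cu * Pu * (1 - 2 * q) ≤ Cu * Pu * (1 - 2 * QL) :=
    mul_le_mul_of_nonneg_left (by linarith) ((mul_nonneg hC0 hP0).trans h1)
  linarith

/-- The `g`-certificate: `0 ≤ C ≤ Cu`, `0 ≤ P ≤ Pu`, `0 ≤ q ≤ QU`, `0 < a`, `a⁻¹ ≤ Au`, `Cu·QU·Pu·Au ≤ g` ⟹ `C·q·P/a ≤ g`. -/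
theorem g_of_cert {C Cu P Pu q QU a Au g : ℝ} (hC0 : 0 ≤ C) (hC : C ≤ Cu) (hP0 : 0 ≤ P) (hP : P ≤ Pu)
    (hq0 : 0 ≤ q) (hq : q ≤ QU) (ha : 0 < a) (hA : a⁻¹ ≤ Au) (hcert : Cu * QU * Pu * Au ≤ g) :
    C * q * P / a ≤ g := by
  have h1 : C * q ≤ Cu * QU := RpowCert.mul_le_cert hC0 hC hq0 hq
  have h2 : C * q * P ≤ Cu * QU * Pu := RpowCert.mul_le_cert (mul_nonneg hC0 hq0) h1 hP0 hP
  have h3 : C * q * P / a = C * q * P * a⁻¹ := div_eq_mul_inv _ _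
  rw [h3]
  exact (RpowCert.mul_le_cert (mul_nonneg (mul_nonneg hC0 hq0) hP0) h2 (inv_nonneg.mpr ha.le) hA).trans hcert

/-! ### Exponent facts and the checked cut -/

/-- The exponent facts of `c₃`: `0 < c₃`, `QL3 ≤ 1/c₃ ≤ QU3`, `2/c₃ ≤ 1`, `0 ≤ 3/c₃ − 1`. -/
theorem c3_facts : 0 < (3 + Real.sqrt 3) / 2 ∧ ((QL3 : ℚ) : ℝ) ≤ ((3 + Real.sqrt 3) / 2)⁻¹ ∧
    ((3 + Real.sqrt 3) / 2)⁻¹ ≤ ((QU3 : ℚ) : ℝ) ∧ 2 * ((3 + Real.sqrt 3) / 2)⁻¹ ≤ 1 ∧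
    0 ≤ 3 * ((3 + Real.sqrt 3) / 2)⁻¹ - 1 := by
  obtain ⟨h1, h2⟩ := RpowCert.inv_c3_bounds
  have e1 : ((QL3 : ℚ) : ℝ) = 422649730810 / 10 ^ 12 := by norm_num [QL3]
  have e2 : ((QU3 : ℚ) : ℝ) = 422649730811 / 10 ^ 12 := by norm_num [QU3]
  refine ⟨by positivity, by rw [e1]; exact h1.le, by rw [e2]; exact h2.le, by linarith, by linarith⟩

/-- The exponent facts of `c₄`. -/
theorem c4_facts : 0 < (3 + Real.sqrt (11 / 3)) / 2 ∧ ((QL4 : ℚ) : ℝ) ≤ ((3 + Real.sqrt (11 / 3)) / 2)⁻¹ ∧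
    ((3 + Real.sqrt (11 / 3)) / 2)⁻¹ ≤ ((QU4 : ℚ) : ℝ) ∧ 2 * ((3 + Real.sqrt (11 / 3)) / 2)⁻¹ ≤ 1 ∧
    0 ≤ 4 * ((3 + Real.sqrt (11 / 3)) / 2)⁻¹ - 1 := by
  obtain ⟨h1, h2⟩ := RpowCert.inv_c4_bounds
  have e1 : ((QL4 : ℚ) : ℝ) = 406929669182 / 10 ^ 12 := by norm_num [QL4]
  have e2 : ((QU4 : ℚ) : ℝ) = 406929669183 / 10 ^ 12 := by norm_num [QU4]
  refine ⟨by positivity, by rw [e1]; exact h1.le, by rw [e2]; exact h2.le, by linarith, by linarith⟩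

/-- From the certified data to the scaled row: `u ≤ H/N + (G₁/N)s + (G₂/N)t`, `N > 0` ⟹ `N·u − G₁·s − G₂·t ≤ H`. -/
theorem row_of_cut {u s t H : ℝ} {N G1 G2 : ℕ} (hN : 0 < N)
    (h : u ≤ H / N + (G1 : ℝ) / N * s + (G2 : ℝ) / N * t) :
    (N : ℝ) * u + -(G1 : ℝ) * s + -(G2 : ℝ) * t ≤ H := by
  have hN' : (0 : ℝ) < N := by exact_mod_cast hN
  have h1 : (N : ℝ) * u ≤ (N : ℝ) * (H / N + (G1 : ℝ) / N * s + (G2 : ℝ) / N * t) :=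
    mul_le_mul_of_nonneg_left h hN'.le
  have e : (N : ℝ) * (H / N + (G1 : ℝ) / N * s + (G2 : ℝ) / N * t) = H + G1 * s + G2 * t := by
    field_simp
  linarith [h1, e]

/-- **The cut of a power row in root form with certified constants.**  `u^c ≤ K·F·s·t`, `F ≤ R`, `(K·R)^{1/c} ≤ Cu`,
exponent brackets `QL ≤ 1/c ≤ QU` (`2/c ≤ 1`), support point `(2^{i/32}, 2^{j/32})` with `(ab)^{1/c} ≤ Pu`, and the three
rational checks ⟹ `N·u − G₁s − G₂t ≤ H`. -/
theorem cut_sound {u K F R s t c : ℝ} {Cu Pu QL QU H : ℚ} {i j : ℤ} {N G1 G2 : ℕ} (hu : 0 ≤ u) (hK : 0 ≤ K)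
    (hF : 0 ≤ F) (hFR : F ≤ R) (hs : 0 ≤ s) (ht : 0 ≤ t) (hc : 0 < c) (hql : (QL : ℝ) ≤ c⁻¹) (hqu : c⁻¹ ≤ (QU : ℝ))
    (hq2 : 2 * c⁻¹ ≤ 1) (row : u ^ c ≤ K * F * s * t) (hC : (K * R) ^ c⁻¹ ≤ (Cu : ℝ))
    (hP : ((2 : ℝ) ^ ((i : ℝ) / 32) * (2 : ℝ) ^ ((j : ℝ) / 32)) ^ c⁻¹ ≤ (Pu : ℝ)) (hN : 0 < N)
    (c1 : Cu * Pu * (1 - 2 * QL) ≤ H / N) (c2 : Cu * QU * Pu * powUp ETAL ETAU (-i) ≤ (G1 : ℚ) / N)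
    (c3 : Cu * QU * Pu * powUp ETAL ETAU (-j) ≤ (G2 : ℚ) / N) :
    (N : ℝ) * u + -(G1 : ℝ) * s + -(G2 : ℝ) * t ≤ H := by
  have ha : (0 : ℝ) < (2 : ℝ) ^ ((i : ℝ) / 32) := by positivity
  have hb : (0 : ℝ) < (2 : ℝ) ^ ((j : ℝ) / 32) := by positivity
  have hC0 : (0 : ℝ) ≤ Cu := (Real.rpow_nonneg (mul_nonneg hK (hF.trans hFR)) _).trans hC
  have hP0 : (0 : ℝ) ≤ ((2 : ℝ) ^ ((i : ℝ) / 32) * (2 : ℝ) ^ ((j : ℝ) / 32)) ^ c⁻¹ := by positivity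
  have c1' : (Cu : ℝ) * Pu * (1 - 2 * QL) ≤ (H : ℝ) / N := by
    have h := (Rat.cast_le (K := ℝ)).mpr c1; push_cast at h; exact h
  have c2' : (Cu : ℝ) * QU * Pu * ((powUp ETAL ETAU (-i) : ℚ) : ℝ) ≤ (G1 : ℝ) / N := by
    have h := (Rat.cast_le (K := ℝ)).mpr c2; push_cast at h; exact h
  have c3' : (Cu : ℝ) * QU * Pu * ((powUp ETAL ETAU (-j) : ℚ) : ℝ) ≤ (G2 : ℝ) / N := by
    have h := (Rat.cast_le (K := ℝ)).mpr c3; push_cast at h; exact h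
  refine row_of_cut hN (tangent_of_power_row hu hK hF hFR hs ht hc hq2 row ha hb hC ?_ ?_ ?_)
  · exact h_of_cert hC0 le_rfl hP0 hP hql hq2 c1'
  · exact g_of_cert hC0 le_rfl hP0 hP (inv_nonneg.mpr hc.le) hqu ha (inv_supp_le i) c2'
  · exact g_of_cert hC0 le_rfl hP0 hP (inv_nonneg.mpr hc.le) hqu hb (inv_supp_le j) c3'

/-- The exponent facts of `5/2` (ISO₅): bracket `2/5` exact. -/
theorem c5_facts : (0 : ℝ) < 5 / 2 ∧ (((2 / 5 : ℚ)) : ℝ) ≤ ((5 : ℝ) / 2)⁻¹ ∧ ((5 : ℝ) / 2)⁻¹ ≤ (((2 / 5 : ℚ)) : ℝ) ∧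
    2 * ((5 : ℝ) / 2)⁻¹ ≤ 1 := by
  refine ⟨by norm_num, by norm_num, by norm_num, by norm_num⟩

end

end TypeTable
end HubOnly

end Summit.CriticalPhenomena.PercolationContinuityZ3.Theorems
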